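import Summits.AtomisticToContinuum.HydrodynamicLimit.Theorems.InformationPercolationEngineChaosClosesEulerPressureValueJ
import HarnessLib

/-!
# Collisional pressure value in band (crux `ChaosClosesEuler`, stmt-AtomisticToContinuum-15141, line `Sketch`,
# stub `stub_pressureValueOfEnskog`) — helper K: the collision side along a good orbit

WHAT. Pathwise estimates for the normalised collision sums of ONE good orbit (`τ = t + 1`, `0 < r < 1/2`):

* `kwindow_measurable_bdd` — the tent × cone WINDOWED collision statistic `K_r(t₀, x₀)` is jointly measurable and
  bounded in the window centre;
* `pec_test` (P4) — testing `K_r − R` against a bounded continuous `a(t₀, x₀)` over `t₀ ∈ [0, t]`: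
  `|K[ã g Ξ] − σ³∫∫ ã F| ≤ A ∫_{t₀ ∈ [0,τ]} ∫_{x₀} |K_r − R|` (exchange lemma of helper D, window transpose of helper E);
* `truncation_le` (P1) — replacing the stress mark `|⟪v⁻ − w⁻, n̂⟫| n̂⊗n̂` by its velocity truncation `𝒯[L,k,l]` costs
  `9 A G_b K[(1 + |vᵢ|² + |vⱼ|²) 1{L² < |vᵢ|² + |vⱼ|²}]` (helper A at every unit normal);
* `coefficient_le` (P2) — replacing the instantaneous coefficient `a 1{s ≤ t}` by the smoothed one `ã` costs
  `9 (ω K_τ[1_{J₀} |g| ℬ] + 2A (K_τ[1_{J₁} |g| ℬ] + K_τ[1_{J₂} |g| ℬ]))` with the interior window `J₀` and the two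
  boundary layers `J₁, J₂` in the format of the layer inequality of helper D.

References: M. Pulvirenti, S. Simonella, arXiv:1504.03215 §3; C. Cercignani, R. Illner, M. Pulvirenti (1994) App. 4.A.
-/

noncomputable section

namespace Summit.AtomisticToContinuum.HydrodynamicLimit.Theorems.ChaosClosesEulerPressureValue

open scoped BigOperators Topology Classical MeasureTheory ENNReal InnerProductSpace
open Filter Set MeasureTheory
open Literature.MathematicalPhysics.KineticTheory
open Literature.Analysis.FluidPDE
open Summit.AtomisticToContinuum.HydrodynamicLimit.Theorems.LocalSecondLawNegative
open Summit.AtomisticToContinuum.HydrodynamicLimit.Theorems.LocalSecondLawLedger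
open Summit.AtomisticToContinuum.HydrodynamicLimit.Theorems.LocalSecondLawLedger.L
  (Mmom rhoC_eq_sum momC_apply_eq_sum momC_eq_sum kinC_eq_trace norm_sq_eq_sum)

/-- The truncated stress mark `𝒯[L,k,l]` (local notation for an explicit lambda). -/
local notation3 "𝒯[" L ", " k ", " l "]" => fun q : V3 × V3 × V3 =>
  min |⟪q.2.1 - q.2.2, q.1⟫_ℝ| (4 * L) * (speedCutoff L ‖q.2.1‖ * speedCutoff L ‖q.2.2‖) * (clip1 (q.1 k) * clip1 (q.1 l))

/-- The dominating mark `ℬ[L]` (local notation for an explicit lambda). -/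
local notation3 "ℬ[" L "]" => fun q : V3 × V3 × V3 => 4 * L * (speedCutoff L ‖q.2.1‖ * speedCutoff L ‖q.2.2‖)

section CollisionSide

open Function

variable {σ : ℝ} {N : ℕ} (Φ : HardSphereFlow (Torus.geometry (Fin 3)) (hsDiameter σ N) (N + 1)) {z : Phase N}

/-! ## §1 The windowed collision statistic in the window centre -/

/-- **The windowed collision statistic is jointly measurable and bounded in the window centre `(t₀, x₀)`** (a finite
sum of products of a tent in `t₀`, a cone in `x₀` and constants; `0 < σ`, `0 < r`). [folklore] -/
theorem kwindow_measurable_bdd (hz : z ∈ Φ.good) (hσ : 0 < σ) {r : ℝ} (hr : 0 < r) (τ : ℝ) (g : ℝ → ℝ)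
    (Ξ : V3 × V3 × V3 → ℝ) :
    Measurable (uncurry fun (t₀ : ℝ) (x₀ : T3) =>
      collisionSum σ N Φ τ (fun p => r⁻¹ * max (1 - |p.1 - t₀| / r) 0 * cone r p.2 x₀) g Ξ r z) ∧
    ∃ C : ℝ, ∀ t₀ x₀, |collisionSum σ N Φ τ (fun p => r⁻¹ * max (1 - |p.1 - t₀| / r) 0 * cone r p.2 x₀) g Ξ r z| ≤ C := by
  constructor
  · have heq : (uncurry fun (t₀ : ℝ) (x₀ : T3) =>
        collisionSum σ N Φ τ (fun p => r⁻¹ * max (1 - |p.1 - t₀| / r) 0 * cone r p.2 x₀) g Ξ r z) =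
        fun q : ℝ × T3 => hsDiameter σ N / (N + 1 : ℝ) *
          ∑ s ∈ (finite_collisionTimes_Icc Φ hz τ).toFinset, ∑ i : Fin (N + 1), ∑ j : Fin (N + 1),
            (if i ≠ j ∧ ‖(Torus.geometry (Fin 3)).sepVec (Φ.flow s z i).1 (Φ.flow s z j).1‖ = hsDiameter σ N then
              r⁻¹ * max (1 - |s - q.1| / r) 0 * cone r (Φ.flow s z i).1 q.2 *
                g (σ ^ 3 * mollDensity r (Φ.flow s z) (Φ.flow s z i).1) *
                Ξ ((hsDiameter σ N)⁻¹ • (Torus.geometry (Fin 3)).sepVec (Φ.flow s z i).1 (Φ.flow s z j).1,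
                  (reflectVel ((Torus.geometry (Fin 3)).sepVec (Φ.flow s z i).1 (Φ.flow s z j).1)
                    ((Φ.flow s z i).2, (Φ.flow s z j).2)).1,
                  (reflectVel ((Torus.geometry (Fin 3)).sepVec (Φ.flow s z i).1 (Φ.flow s z j).1)
                    ((Φ.flow s z i).2, (Φ.flow s z j).2)).2)
            else 0) := by
      funext q
      exact collisionSum_eq_sum Φ hz τ (fun p => r⁻¹ * max (1 - |p.1 - q.1| / r) 0 * cone r p.2 q.2) g Ξ r
    rw [heq]
    refine measurable_const.mul (Finset.measurable_sum _ fun s _ => Finset.measurable_sum _ fun i _ =>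
      Finset.measurable_sum _ fun j _ => ?_)
    by_cases hc : i ≠ j ∧ ‖(Torus.geometry (Fin 3)).sepVec (Φ.flow s z i).1 (Φ.flow s z j).1‖ = hsDiameter σ N
    · simp only [if_pos hc]
      refine ((Measurable.mul ?_ ?_).mul measurable_const).mul measurable_const
      · exact (continuous_tent_sub r s).measurable.comp measurable_fst
      · exact (continuous_cone r _).measurable.comp measurable_snd
    · simp only [if_neg hc]; exact measurable_const
  · refine ⟨collisionSum σ N Φ τ (fun _ => r⁻¹ * (3 / (Real.pi * r ^ 3))) (fun b => |g b|) (fun q => |Ξ q|) r z,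
      fun t₀ x₀ => ?_⟩
    have h := abs_collisionSum_sub_le Φ hz hσ r (τ := τ)
      (χ₁ := fun p => r⁻¹ * max (1 - |p.1 - t₀| / r) 0 * cone r p.2 x₀) (χ₂ := fun _ => 0)
      (χ₃ := fun _ => r⁻¹ * (3 / (Real.pi * r ^ 3))) (g₁ := g) (g₂ := g) (g₃ := fun b => |g b|)
      (Ξ₁ := Ξ) (Ξ₂ := Ξ) (Ξ₃ := fun q => |Ξ q|) (fun s _ x b q _ => by
        have ht := ChaosClosesEulerWindowedInvariance.tent_nonneg_le hr (s - t₀)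
        have hc0 := cone_nonneg hr x x₀
        have hc1 : cone r x x₀ ≤ 3 / (Real.pi * r ^ 3) := (le_abs_self _).trans (LocalSecondLawLedger.L.abs_cone_le hr _ _)
        rw [zero_mul, zero_mul, sub_zero, abs_mul, abs_mul, abs_mul, abs_of_nonneg ht.1, abs_of_nonneg hc0]
        exact mul_le_mul_of_nonneg_right (mul_le_mul_of_nonneg_right
          (mul_le_mul ht.2 hc1 hc0 (inv_nonneg.2 hr.le)) (abs_nonneg _)) (abs_nonneg _))
    have h0 : collisionSum σ N Φ τ (fun _ => (0 : ℝ)) g Ξ r z = 0 := by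
      have := collisionSum_const_mul Φ hz τ 0 (fun _ => (1 : ℝ)) g Ξ r
      simp only [zero_mul] at this
      exact this
    rw [h0, sub_zero] at h
    exact h

/-! ## §2 (P4) Testing the windowed statistics against a coefficient -/

/-- **(P4) The pointwise-Enskog-collision test**: for a bounded continuous `a` on the window `t₀ ∈ [0, t]` and a
bounded jointly measurable field `F`,
`|K_τ[ã g Ξ] − σ³ ∫_{[0,τ]} ∫_x ã F| ≤ A ∫_{t₀ ∈ [0,τ]} ∫_{x₀} |K_r(t₀,x₀) − R(t₀,x₀)|`
with `R(t₀, x₀) = σ³ ∫_s bt(s − t₀) ∫_x b_r(x, x₀) F(s, x)` (`t ≤ τ`). [folklore] -/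
theorem pec_test (hz : z ∈ Φ.good) (hσ : 0 < σ) {r : ℝ} (hr : 0 < r) (hr2 : r < 1 / 2) {t τ : ℝ}
    (htτ : t ≤ τ) {a : ℝ × T3 → ℝ} (ha : Continuous a) {A : ℝ} (hA : ∀ p, |a p| ≤ A) (g : ℝ → ℝ)
    (Ξ : V3 × V3 × V3 → ℝ) {F : ℝ → T3 → ℝ} (hF : Measurable (uncurry F)) {C : ℝ} (hFb : ∀ s x, |F s x| ≤ C) :
    |collisionSum σ N Φ τ (fun p => ∫ t₀ in Icc 0 t, ∫ x₀,
        a (t₀, x₀) * (r⁻¹ * max (1 - |p.1 - t₀| / r) 0 * cone r p.2 x₀)) g Ξ r z -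
      σ ^ 3 * ∫ s in Icc 0 τ, ∫ x, (∫ t₀ in Icc 0 t, ∫ x₀,
        a (t₀, x₀) * (r⁻¹ * max (1 - |s - t₀| / r) 0 * cone r x x₀)) * F s x| ≤
      A * ∫ t₀ in Icc 0 τ, ∫ x₀, |collisionSum σ N Φ τ (fun p => r⁻¹ * max (1 - |p.1 - t₀| / r) 0 * cone r p.2 x₀) g Ξ r z -
        σ ^ 3 * ∫ s in Icc 0 τ, r⁻¹ * max (1 - |s - t₀| / r) 0 * ∫ x, cone r x x₀ * F s x| := by
  have hA0 : 0 ≤ A := (abs_nonneg _).trans (hA (0, 0))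
  -- both sides as window integrals against `a`
  rw [← integral_integral_mul_collisionSum_window Φ hz ha τ 0 t r g Ξ,
    ← integral_integral_mul_window_eq ha hA hr hF hFb σ 0 t τ]
  -- the two window fields
  obtain ⟨hKm, CK, hKb⟩ := kwindow_measurable_bdd Φ hz hσ hr τ g Ξ
  set Kf : ℝ → T3 → ℝ := fun t₀ x₀ =>
    collisionSum σ N Φ τ (fun p => r⁻¹ * max (1 - |p.1 - t₀| / r) 0 * cone r p.2 x₀) g Ξ r z with hKf
  set Rf : ℝ → T3 → ℝ := fun t₀ x₀ =>
    σ ^ 3 * ∫ s in Icc 0 τ, r⁻¹ * max (1 - |s - t₀| / r) 0 * ∫ x, cone r x x₀ * F s x with hRf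
  have hRm : Measurable (uncurry Rf) := by
    have h := (measurable_windowField hr hF hFb τ).const_mul (σ ^ 3)
    exact h
  have hC0 : 0 ≤ C := (abs_nonneg _).trans (hFb 0 0)
  have hRb : ∀ t₀ x₀, |Rf t₀ x₀| ≤ σ ^ 3 * C := fun t₀ x₀ => by
    simp only [hRf]
    rw [abs_mul, abs_of_nonneg (pow_nonneg hσ.le 3)]
    exact mul_le_mul_of_nonneg_left (abs_windowField_le hr hr2 hFb τ t₀ x₀) (pow_nonneg hσ.le 3)
  have ham : Measurable (uncurry fun t₀ x₀ => a (t₀, x₀) * Kf t₀ x₀) := (ha.measurable.comp measurable_id).mul hKm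
  have hab : ∀ t₀ x₀, |a (t₀, x₀) * Kf t₀ x₀| ≤ A * CK := fun t₀ x₀ => by
    rw [abs_mul]; exact mul_le_mul (hA _) (hKb t₀ x₀) (abs_nonneg _) hA0
  have hbm : Measurable (uncurry fun t₀ x₀ => a (t₀, x₀) * Rf t₀ x₀) := (ha.measurable.comp measurable_id).mul hRm
  have hbb : ∀ t₀ x₀, |a (t₀, x₀) * Rf t₀ x₀| ≤ A * (σ ^ 3 * C) := fun t₀ x₀ => by
    rw [abs_mul]; exact mul_le_mul (hA _) (hRb t₀ x₀) (abs_nonneg _) hA0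
  have hsub := setIntegral_integral_sub ham hab hbm hbb 0 t
  simp only [hKf, hRf] at hsub
  rw [← hsub]
  -- domination by `A |K − R|` and monotonicity in the window
  have hGm : Measurable (uncurry fun t₀ x₀ => A * (|Kf t₀ x₀ - Rf t₀ x₀|)) := (hKm.sub hRm).abs.const_mul A
  have hGb : ∀ t₀ x₀, |A * (|Kf t₀ x₀ - Rf t₀ x₀|)| ≤ A * (CK + σ ^ 3 * C) := fun t₀ x₀ => by
    rw [abs_mul, abs_of_nonneg hA0, abs_abs]
    exact mul_le_mul_of_nonneg_left ((abs_sub _ _).trans (add_le_add (hKb _ _) (hRb _ _))) hA0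
  have hdom : ∀ t₀ ∈ Icc (0 : ℝ) t, ∀ x₀, |a (t₀, x₀) * Kf t₀ x₀ - a (t₀, x₀) * Rf t₀ x₀| ≤ A * (|Kf t₀ x₀ - Rf t₀ x₀|) :=
    fun t₀ _ x₀ => by rw [← mul_sub, abs_mul]; exact mul_le_mul_of_nonneg_right (hA _) (abs_nonneg _)
  have h1 := abs_setIntegral_integral_le_of_le hGm hGb hdom
  simp only [hKf, hRf] at h1 hGm hGb
  refine h1.trans ?_
  rw [setIntegral_integral_const_mul]
  refine mul_le_mul_of_nonneg_left ?_ hA0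
  have hG'm : Measurable (uncurry fun t₀ x₀ => |Kf t₀ x₀ - Rf t₀ x₀|) := (hKm.sub hRm).abs
  have hG'b : ∀ t₀ x₀, |(|Kf t₀ x₀ - Rf t₀ x₀|)| ≤ CK + σ ^ 3 * C := fun t₀ x₀ => by
    rw [abs_abs]; exact (abs_sub _ _).trans (add_le_add (hKb _ _) (hRb _ _))
  have h2 := setIntegral_integral_mono_set hG'm hG'b (fun t₀ x₀ => abs_nonneg _) (Icc_subset_Icc (le_refl (0 : ℝ)) htτ)
  simp only [hKf, hRf] at h2
  exact h2

/-! ## §3 (P1) Velocity truncation of the stress mark -/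

/-- **(P1) Velocity truncation costs the quadratic collision mark.** With `|a_kl| ≤ A`, `|g| ≤ G_b` on `[0,∞)`,
`0 < L`, `0 ≤ σ`:
`|Σ_kl K[a_kl g (|⟪v⁻−w⁻,n̂⟫| n̂ₖn̂ₗ)] − Σ_kl K[a_kl g 𝒯[L,k,l]]| ≤ 9 A G_b K[(1 + |v|² + |w|²) 1{L² < |v|² + |w|²}]`
(`|g| ≤ G_b` everywhere). [folklore] -/
theorem truncation_le (hz : z ∈ Φ.good) (hσ : 0 < σ) {r L : ℝ} (hL : 0 < L) (τ : ℝ)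
    (a : Fin 3 → Fin 3 → ℝ × T3 → ℝ) {A : ℝ} (hA : ∀ k l p, |a k l p| ≤ A) (g : ℝ → ℝ) {Gb : ℝ}
    (hg : ∀ b, |g b| ≤ Gb) :
    |(∑ k : Fin 3, ∑ l : Fin 3, collisionSum σ N Φ τ (a k l) g
        (fun q => |⟪q.2.1 - q.2.2, q.1⟫_ℝ| * (q.1 k * q.1 l)) r z) -
      ∑ k : Fin 3, ∑ l : Fin 3, collisionSum σ N Φ τ (a k l) g 𝒯[L, k, l] r z| ≤
      9 * (A * Gb) * collisionSum σ N Φ τ (fun _ => 1) (fun _ => 1)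
        (fun q => if L ^ 2 < ‖q.2.1‖ ^ 2 + ‖q.2.2‖ ^ 2 then 1 + ‖q.2.1‖ ^ 2 + ‖q.2.2‖ ^ 2 else 0) r z := by
  have hA0 : 0 ≤ A := (abs_nonneg _).trans (hA 0 0 (0, 0))
  have hGb : 0 ≤ Gb := (abs_nonneg _).trans (hg 0)
  rw [← Finset.sum_sub_distrib]
  have hterm : ∀ k l, |collisionSum σ N Φ τ (a k l) g (fun q => |⟪q.2.1 - q.2.2, q.1⟫_ℝ| * (q.1 k * q.1 l)) r z -
      collisionSum σ N Φ τ (a k l) g 𝒯[L, k, l] r z| ≤ (A * Gb) * collisionSum σ N Φ τ (fun _ => 1) (fun _ => 1)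
        (fun q => if L ^ 2 < ‖q.2.1‖ ^ 2 + ‖q.2.2‖ ^ 2 then 1 + ‖q.2.1‖ ^ 2 + ‖q.2.2‖ ^ 2 else 0) r z := by
    intro k l
    rw [← collisionSum_const_mul Φ hz]
    refine abs_collisionSum_sub_le Φ hz hσ r fun s _ x b q hq => ?_
    have hT : min |⟪q.2.1 - q.2.2, q.1⟫_ℝ| (4 * L) * (speedCutoff L ‖q.2.1‖ * speedCutoff L ‖q.2.2‖) *
        (clip1 (q.1 k) * clip1 (q.1 l)) =
        |⟪q.2.1 - q.2.2, q.1⟫_ℝ| * (speedCutoff L ‖q.2.1‖ * speedCutoff L ‖q.2.2‖) * (q.1 k * q.1 l) := by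
      have h := markT_eq_of_norm_eq_one hL k l hq q.2.1 q.2.2
      exact h
    rw [hT]
    have hk : |q.1 k| ≤ 1 := by
      have := PiLp.norm_apply_le q.1 k; rwa [hq, Real.norm_eq_abs] at this
    have hl : |q.1 l| ≤ 1 := by
      have := PiLp.norm_apply_le q.1 l; rwa [hq, Real.norm_eq_abs] at this
    have hnn : |q.1 k * q.1 l| ≤ 1 := by rw [abs_mul]; exact mul_le_one₀ hk (abs_nonneg _) hl
    have hin := abs_inner_mul_one_sub_cc_le hL hq q.2.1 q.2.2
    have e : a k l (s, x) * g b * (|⟪q.2.1 - q.2.2, q.1⟫_ℝ| * (q.1 k * q.1 l)) -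
        a k l (s, x) * g b * (|⟪q.2.1 - q.2.2, q.1⟫_ℝ| * (speedCutoff L ‖q.2.1‖ * speedCutoff L ‖q.2.2‖) * (q.1 k * q.1 l)) =
        a k l (s, x) * g b * ((|⟪q.2.1 - q.2.2, q.1⟫_ℝ| * (1 - speedCutoff L ‖q.2.1‖ * speedCutoff L ‖q.2.2‖)) *
          (q.1 k * q.1 l)) := by ring
    have h0 : 0 ≤ |⟪q.2.1 - q.2.2, q.1⟫_ℝ| * (1 - speedCutoff L ‖q.2.1‖ * speedCutoff L ‖q.2.2‖) :=
      mul_nonneg (abs_nonneg _) (by linarith [(cc_mem L q.2.1 q.2.2).2])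
    have hite : 0 ≤ (if L ^ 2 < ‖q.2.1‖ ^ 2 + ‖q.2.2‖ ^ 2 then 1 + ‖q.2.1‖ ^ 2 + ‖q.2.2‖ ^ 2 else (0 : ℝ)) := by
      split_ifs <;> positivity
    rw [e, abs_mul, abs_mul, abs_mul, abs_of_nonneg h0]
    calc |a k l (s, x)| * |g b| * (|⟪q.2.1 - q.2.2, q.1⟫_ℝ| * (1 - speedCutoff L ‖q.2.1‖ * speedCutoff L ‖q.2.2‖) *
          |q.1 k * q.1 l|)
        ≤ A * Gb * ((if L ^ 2 < ‖q.2.1‖ ^ 2 + ‖q.2.2‖ ^ 2 then 1 + ‖q.2.1‖ ^ 2 + ‖q.2.2‖ ^ 2 else 0) * 1) :=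
          mul_le_mul (mul_le_mul (hA k l _) (hg b) (abs_nonneg _) hA0)
            (mul_le_mul hin hnn (abs_nonneg _) hite) (by positivity) (by positivity)
      _ = A * Gb * 1 * 1 * (if L ^ 2 < ‖q.2.1‖ ^ 2 + ‖q.2.2‖ ^ 2 then 1 + ‖q.2.1‖ ^ 2 + ‖q.2.2‖ ^ 2 else 0) := by ring
  calc _ ≤ ∑ k : Fin 3, ∑ l : Fin 3, |collisionSum σ N Φ τ (a k l) g (fun q => |⟪q.2.1 - q.2.2, q.1⟫_ℝ| * (q.1 k * q.1 l)) r z -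
        collisionSum σ N Φ τ (a k l) g 𝒯[L, k, l] r z| :=
        (Finset.abs_sum_le_sum_abs _ _).trans (Finset.sum_le_sum fun k _ => by
          rw [← Finset.sum_sub_distrib]; exact Finset.abs_sum_le_sum_abs _ _)
    _ ≤ ∑ _k : Fin 3, ∑ _l : Fin 3, (A * Gb) * collisionSum σ N Φ τ (fun _ => 1) (fun _ => 1)
        (fun q => if L ^ 2 < ‖q.2.1‖ ^ 2 + ‖q.2.2‖ ^ 2 then 1 + ‖q.2.1‖ ^ 2 + ‖q.2.2‖ ^ 2 else 0) r z :=
        Finset.sum_le_sum fun k _ => Finset.sum_le_sum fun l _ => hterm k l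
    _ = _ := by simp only [Finset.sum_const, Finset.card_univ, Fintype.card_fin, nsmul_eq_mul]; push_cast; ring

/-! ## §4 (P2) Smoothed versus instantaneous coefficient on the collision side -/

/-- The pointwise coefficient comparison: for `s ∈ [0, t+1]`,
`|a(s,x) 1{s ≤ t} − ã(s,x)| ≤ ω 1_{J₀}(s) + 2A (1_{J₁}(s) + 1_{J₂}(s))` with the interior window
`J₀ = {0 ≤ s, s + r ≤ t + 2r}` and the layers `J₁ = {0 ≤ s, s + r ≤ 2r}`, `J₂ = {max 0 (t−r) ≤ s, s + r ≤ t + 2r}`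
(`0 < r < 1/2`, `ω` a joint `r`-modulus of `a`, `|a| ≤ A`). [folklore] -/
theorem abs_cutCoeff_sub_smoothCoeff_le {a : ℝ × T3 → ℝ} (ha : Continuous a) {A : ℝ} (hA : ∀ p, |a p| ≤ A)
    {r : ℝ} (hr : 0 < r) (hr2 : r < 1 / 2) {t : ℝ} {ω : ℝ} (hω0 : 0 ≤ ω)
    (hω : ∀ (s t₀ : ℝ) (x x₀ : T3), |s - t₀| < r → Torus.euclidDist x x₀ < r → |a (t₀, x₀) - a (s, x)| ≤ ω)
    {s : ℝ} (hs : s ∈ Icc 0 (t + 1)) (x : T3) :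
    |(if s ≤ t then a (s, x) else 0) - ∫ t₀ in Icc 0 t, ∫ x₀,
        a (t₀, x₀) * (r⁻¹ * max (1 - |s - t₀| / r) 0 * cone r x x₀)| ≤
      ω * (if 0 ≤ s ∧ s + r ≤ t + 2 * r then 1 else 0) +
        2 * A * ((if 0 ≤ s ∧ s + r ≤ 2 * r then 1 else 0) + (if max 0 (t - r) ≤ s ∧ s + r ≤ t + 2 * r then 1 else 0)) := by
  have hA0 : 0 ≤ A := (abs_nonneg _).trans (hA (0, 0))
  have hã := abs_smoothCoeff_le ha hr hr2 hA t s x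
  have h2A : |(if s ≤ t then a (s, x) else 0) - ∫ t₀ in Icc 0 t, ∫ x₀,
      a (t₀, x₀) * (r⁻¹ * max (1 - |s - t₀| / r) 0 * cone r x x₀)| ≤ 2 * A := by
    refine (abs_sub _ _).trans ?_
    have : |(if s ≤ t then a (s, x) else 0)| ≤ A := by split_ifs <;> [exact hA _; (rw [abs_zero]; exact hA0)]
    linarith
  have i0 : 0 ≤ (if 0 ≤ s ∧ s + r ≤ t + 2 * r then (1 : ℝ) else 0) := by split_ifs <;> norm_num
  have i1 : 0 ≤ (if 0 ≤ s ∧ s + r ≤ 2 * r then (1 : ℝ) else 0) := by split_ifs <;> norm_num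
  have i2 : 0 ≤ (if max 0 (t - r) ≤ s ∧ s + r ≤ t + 2 * r then (1 : ℝ) else 0) := by split_ifs <;> norm_num
  by_cases h1 : s < r
  · -- left layer
    have e1 : (if 0 ≤ s ∧ s + r ≤ 2 * r then (1 : ℝ) else 0) = 1 := if_pos ⟨hs.1, by linarith⟩
    rw [e1]; nlinarith
  · push Not at h1
    by_cases h2 : s + r ≤ t
    · -- interior
      have e0 : (if 0 ≤ s ∧ s + r ≤ t + 2 * r then (1 : ℝ) else 0) = 1 := if_pos ⟨hs.1, by linarith⟩
      rw [e0, if_pos (by linarith : s ≤ t)]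
      have h := abs_smoothCoeff_sub_le ha hr hr2 h1 h2 (x := x) (κ := ω) (fun t₀ x₀ ha hb => hω s t₀ x x₀ ha hb)
      rw [abs_sub_comm] at h
      nlinarith
    · push Not at h2
      by_cases h3 : s < t + r
      · -- right layer
        have e2 : (if max 0 (t - r) ≤ s ∧ s + r ≤ t + 2 * r then (1 : ℝ) else 0) = 1 :=
          if_pos ⟨max_le hs.1 (by linarith), by linarith⟩
        rw [e2]; nlinarith
      · -- past the window: both coefficients vanish
        push Not at h3
        rw [if_neg (by linarith : ¬ s ≤ t), smoothCoeff_eq_zero a hr h3 x, sub_zero, abs_zero]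
        positivity

/-- **(P2) Smoothed versus instantaneous coefficient on the collision side.** For `|g| ≤ G_b`-free bookkeeping
(the mark `𝒯` is dominated by `ℬ`):
`|Σ_kl K_t[a_kl g 𝒯_kl] − Σ_kl K_{t+1}[ã_kl g 𝒯_kl]| ≤ 9 (ω K[1_{J₀} |g| ℬ] + 2A (K[1_{J₁} |g| ℬ] + K[1_{J₂} |g| ℬ]))`.
[folklore] -/
theorem coefficient_le (hz : z ∈ Φ.good) (hσ : 0 < σ) {r L : ℝ} (hr : 0 < r) (hr2 : r < 1 / 2) (hL : 0 < L)
    (t : ℝ) (a : Fin 3 → Fin 3 → ℝ × T3 → ℝ) (ha : ∀ k l, Continuous (a k l)) {A : ℝ}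
    (hA : ∀ k l p, |a k l p| ≤ A) {ω : ℝ} (hω0 : 0 ≤ ω)
    (hω : ∀ k l (s t₀ : ℝ) (x x₀ : T3), |s - t₀| < r → Torus.euclidDist x x₀ < r → |a k l (t₀, x₀) - a k l (s, x)| ≤ ω)
    (g : ℝ → ℝ) :
    |(∑ k : Fin 3, ∑ l : Fin 3, collisionSum σ N Φ t (a k l) g 𝒯[L, k, l] r z) -
      ∑ k : Fin 3, ∑ l : Fin 3, collisionSum σ N Φ (t + 1) (fun p => ∫ t₀ in Icc 0 t, ∫ x₀,
        a k l (t₀, x₀) * (r⁻¹ * max (1 - |p.1 - t₀| / r) 0 * cone r p.2 x₀)) g 𝒯[L, k, l] r z| ≤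
      9 * (ω * collisionSum σ N Φ (t + 1) (fun p => if 0 ≤ p.1 ∧ p.1 + r ≤ t + 2 * r then 1 else 0)
          (fun b => |g b|) ℬ[L] r z +
        2 * A * (collisionSum σ N Φ (t + 1) (fun p => if 0 ≤ p.1 ∧ p.1 + r ≤ 2 * r then 1 else 0) (fun b => |g b|) ℬ[L] r z +
          collisionSum σ N Φ (t + 1) (fun p => if max 0 (t - r) ≤ p.1 ∧ p.1 + r ≤ t + 2 * r then 1 else 0)
            (fun b => |g b|) ℬ[L] r z)) := by
  have hA0 : 0 ≤ A := (abs_nonneg _).trans (hA 0 0 (0, 0))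
  set K0 := collisionSum σ N Φ (t + 1) (fun p => if 0 ≤ p.1 ∧ p.1 + r ≤ t + 2 * r then 1 else 0)
    (fun b => |g b|) ℬ[L] r z with hK0
  set K1 := collisionSum σ N Φ (t + 1) (fun p => if 0 ≤ p.1 ∧ p.1 + r ≤ 2 * r then 1 else 0)
    (fun b => |g b|) ℬ[L] r z with hK1
  set K2 := collisionSum σ N Φ (t + 1) (fun p => if max 0 (t - r) ≤ p.1 ∧ p.1 + r ≤ t + 2 * r then 1 else 0)
    (fun b => |g b|) ℬ[L] r z with hK2
  -- the layer weight as a collision-sum weight, and its linear decomposition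
  have hlin : collisionSum σ N Φ (t + 1) (fun p => ω * (if 0 ≤ p.1 ∧ p.1 + r ≤ t + 2 * r then 1 else 0) +
      2 * A * ((if 0 ≤ p.1 ∧ p.1 + r ≤ 2 * r then 1 else 0) + (if max 0 (t - r) ≤ p.1 ∧ p.1 + r ≤ t + 2 * r then 1 else 0)))
      (fun b => |g b|) ℬ[L] r z = ω * K0 + 2 * A * (K1 + K2) := by
    rw [collisionSum_add Φ hz, collisionSum_const_mul Φ hz, collisionSum_const_mul Φ hz, collisionSum_add Φ hz]
  have hterm : ∀ k l, |collisionSum σ N Φ t (a k l) g 𝒯[L, k, l] r z -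
      collisionSum σ N Φ (t + 1) (fun p => ∫ t₀ in Icc 0 t, ∫ x₀,
        a k l (t₀, x₀) * (r⁻¹ * max (1 - |p.1 - t₀| / r) 0 * cone r p.2 x₀)) g 𝒯[L, k, l] r z| ≤
      ω * K0 + 2 * A * (K1 + K2) := by
    intro k l
    rw [← collisionSum_indicator Φ hz (by linarith : t ≤ t + 1) (a k l), ← hlin]
    refine abs_collisionSum_sub_le Φ hz hσ r fun s hs x b q hq => ?_
    rw [← sub_mul, ← sub_mul, abs_mul, abs_mul]
    have hc := abs_cutCoeff_sub_smoothCoeff_le (ha k l) (hA k l) hr hr2 hω0 (hω k l) hs x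
    have hmark := abs_markT_le_markB hL k l q
    have hite : |(if s ≤ t then a k l (s, x) else 0) - ∫ t₀ in Icc 0 t, ∫ x₀,
        a k l (t₀, x₀) * (r⁻¹ * max (1 - |s - t₀| / r) 0 * cone r x x₀)| =
        |(fun p : ℝ × T3 => if p.1 ≤ t then a k l p else 0) (s, x) - ∫ t₀ in Icc 0 t, ∫ x₀,
          a k l (t₀, x₀) * (r⁻¹ * max (1 - |(s, x).1 - t₀| / r) 0 * cone r (s, x).2 x₀)| := rfl
    refine mul_le_mul (mul_le_mul (hite ▸ hc) le_rfl (abs_nonneg _) ?_) hmark (abs_nonneg _) ?_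
    · have i0 : 0 ≤ (if 0 ≤ s ∧ s + r ≤ t + 2 * r then (1 : ℝ) else 0) := by split_ifs <;> norm_num
      have i1 : 0 ≤ (if 0 ≤ s ∧ s + r ≤ 2 * r then (1 : ℝ) else 0) := by split_ifs <;> norm_num
      have i2 : 0 ≤ (if max 0 (t - r) ≤ s ∧ s + r ≤ t + 2 * r then (1 : ℝ) else 0) := by split_ifs <;> norm_num
      positivity
    · refine mul_nonneg ?_ (abs_nonneg _)
      have i0 : 0 ≤ (if 0 ≤ s ∧ s + r ≤ t + 2 * r then (1 : ℝ) else 0) := by split_ifs <;> norm_num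
      have i1 : 0 ≤ (if 0 ≤ s ∧ s + r ≤ 2 * r then (1 : ℝ) else 0) := by split_ifs <;> norm_num
      have i2 : 0 ≤ (if max 0 (t - r) ≤ s ∧ s + r ≤ t + 2 * r then (1 : ℝ) else 0) := by split_ifs <;> norm_num
      positivity
  rw [← Finset.sum_sub_distrib]
  calc _ ≤ ∑ k : Fin 3, ∑ l : Fin 3, |collisionSum σ N Φ t (a k l) g 𝒯[L, k, l] r z -
        collisionSum σ N Φ (t + 1) (fun p => ∫ t₀ in Icc 0 t, ∫ x₀,
          a k l (t₀, x₀) * (r⁻¹ * max (1 - |p.1 - t₀| / r) 0 * cone r p.2 x₀)) g 𝒯[L, k, l] r z| :=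
        (Finset.abs_sum_le_sum_abs _ _).trans (Finset.sum_le_sum fun k _ => by
          rw [← Finset.sum_sub_distrib]; exact Finset.abs_sum_le_sum_abs _ _)
    _ ≤ ∑ _k : Fin 3, ∑ _l : Fin 3, (ω * K0 + 2 * A * (K1 + K2)) :=
        Finset.sum_le_sum fun k _ => Finset.sum_le_sum fun l _ => hterm k l
    _ = 9 * (ω * K0 + 2 * A * (K1 + K2)) := by
        simp only [Finset.sum_const, Finset.card_univ, Fintype.card_fin, nsmul_eq_mul]; push_cast; ring

end CollisionSide

/-! ## Registered sub-goal -/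

/-- **Registered sub-goal `stub_pressureValueK` (helper K of `stub_pressureValueOfEnskog`): the pointwise
comparison of the instantaneous and the smoothed coefficient.** [folklore] -/
theorem stub_pressureValueK : ∀ {a : ℝ × T3 → ℝ}, Continuous a → ∀ {A : ℝ}, (∀ p, |a p| ≤ A) → ∀ {r : ℝ}, 0 < r → r < 1 / 2 → ∀ {t ω : ℝ}, 0 ≤ ω → (∀ (s t₀ : ℝ) (x x₀ : T3), |s - t₀| < r → Torus.euclidDist x x₀ < r → |a (t₀, x₀) - a (s, x)| ≤ ω) → ∀ {s : ℝ}, s ∈ Set.Icc 0 (t + 1) → ∀ (x : T3), |(if s ≤ t then a (s, x) else 0) - ∫ t₀ in Set.Icc 0 t, ∫ x₀, a (t₀, x₀) * (r⁻¹ * max (1 - |s - t₀| / r) 0 * cone r x x₀)| ≤ ω * (if 0 ≤ s ∧ s + r ≤ t + 2 * r then 1 else 0) + 2 * A * ((if 0 ≤ s ∧ s + r ≤ 2 * r then 1 else 0) + (if max 0 (t - r) ≤ s ∧ s + r ≤ t + 2 * r then 1 else 0)) :=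
  fun ha _ hA _ hr hr2 _ _ hω0 hω _ hs x => abs_cutCoeff_sub_smoothCoeff_le ha hA hr hr2 hω0 hω hs x

end Summit.AtomisticToContinuum.HydrodynamicLimit.Theorems.ChaosClosesEulerPressureValue

end
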